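import Mathlib
import Summits.Ventures.HodgeRepro2.T5TeichmullerLift
import Summits.Ventures.HodgeRepro2.T5CircleCharacterCount

/-!
# `O_Kv^× / U¹ ≅ k^×`, and the count of tame characters

The reduction `O_Kvˣ →* kˣ` (`unitsResidue := Units.map (residue O_Kv)`) is surjective
(Teichmüller lifts, `T5TeichmullerLift`) with kernel the principal units `U¹ = {u | residue u = 1}`
(`principalUnits`), so `O_Kvˣ ⧸ U¹ ≃* kˣ` (`quotientPrincipalUnitsEquiv`) and
`[O_Kvˣ : U¹] = q − 1` (`index_principalUnits`).  Consequently the characters of `O_Kvˣ` trivial on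
`U¹` — the TAME characters, cf. `T5PrincipalUnitsDivisible` — are exactly `q − 1` in number
(`card_tameCharacters`, via `T5CircleCharacterCount`): route/T5-route-2.md's (A10) count of the
characters of `O_{F_v}^×` of conductor `≤ 1`.

Declaration per README §8(d): «uses an L-value-free non-vanishing device: NO».
-/

namespace Summit.Ventures.HodgeRepro2.T5UnitsResidueQuotient

open IsDedekindDomain HeightOneSpectrum IsLocalRing

variable {K : Type*} [Field K] [NumberField K] (v : HeightOneSpectrum (NumberField.RingOfIntegers K))

/-- The reduction map on units `O_Kvˣ →* kˣ`. -/
noncomputable def unitsResidue : (adicCompletionIntegers K v)ˣ →* (ResidueField (adicCompletionIntegers K v))ˣ :=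
  Units.map (residue (adicCompletionIntegers K v) : adicCompletionIntegers K v →* ResidueField (adicCompletionIntegers K v))

/-- `unitsResidue` on underlying elements. -/
theorem coe_unitsResidue (u : (adicCompletionIntegers K v)ˣ) :
    ((unitsResidue v u : (ResidueField (adicCompletionIntegers K v))ˣ) : ResidueField (adicCompletionIntegers K v)) =
      residue (adicCompletionIntegers K v) (u : adicCompletionIntegers K v) := rfl

/-- The principal units `U¹ = {u | residue u = 1}` as a subgroup: the kernel of `unitsResidue`. -/
noncomputable def principalUnits : Subgroup (adicCompletionIntegers K v)ˣ := (unitsResidue v).ker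

/-- Membership in `U¹`. -/
theorem mem_principalUnits_iff (u : (adicCompletionIntegers K v)ˣ) :
    u ∈ principalUnits v ↔ residue (adicCompletionIntegers K v) (u : adicCompletionIntegers K v) = 1 := by
  rw [principalUnits, MonoidHom.mem_ker, Units.ext_iff, coe_unitsResidue, Units.val_one]

/-- SURJECTIVITY of the reduction on units (Teichmüller lifts). -/
theorem unitsResidue_surjective : Function.Surjective (unitsResidue v) := by
  intro z
  obtain ⟨ζ, -, hζ⟩ := T5TeichmullerLift.exists_rootsOfUnity_residue_eq v (z : ResidueField (adicCompletionIntegers K v)) z.ne_zero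
  exact ⟨ζ, Units.ext hζ⟩

/-- `O_Kvˣ ⧸ U¹ ≃* kˣ`. -/
noncomputable def quotientPrincipalUnitsEquiv :
    (adicCompletionIntegers K v)ˣ ⧸ principalUnits v ≃* (ResidueField (adicCompletionIntegers K v))ˣ :=
  QuotientGroup.quotientKerEquivOfSurjective (unitsResidue v) (unitsResidue_surjective v)

/-- `[O_Kvˣ : U¹] = q − 1`. -/
theorem index_principalUnits :
    (principalUnits v).index = Nat.card (ResidueField (adicCompletionIntegers K v)) - 1 := by
  rw [← Nat.card_units, Subgroup.index, Nat.card_congr (quotientPrincipalUnitsEquiv v).toEquiv]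

/-- `O_Kvˣ ⧸ U¹` is finite. -/
instance finite_quotient_principalUnits : Finite ((adicCompletionIntegers K v)ˣ ⧸ principalUnits v) :=
  Finite.of_equiv _ (quotientPrincipalUnitsEquiv v).toEquiv.symm

/-- THE COUNT OF TAME CHARACTERS: the characters of `O_Kvˣ ⧸ U¹` (= the characters of `O_Kvˣ`
trivial on the principal units) number `q − 1`. -/
theorem card_tameCharacters :
    Nat.card (((adicCompletionIntegers K v)ˣ ⧸ principalUnits v) →* Circle) =
      Nat.card (ResidueField (adicCompletionIntegers K v)) - 1 := by
  have h := T5CircleCharacterCount.card_monoidHom_circle ((adicCompletionIntegers K v)ˣ ⧸ principalUnits v)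
  rw [h, ← index_principalUnits, Subgroup.index]

end Summit.Ventures.HodgeRepro2.T5UnitsResidueQuotient
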